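import Literature.Computability.QuantumComplexity.PureStateSamplingBound
import HarnessLib

/-!
# Truncating a pure state onto part of an orthonormal family: discarded weight, fidelity, and the
  error of diagonal observables

Topic `Literature/Computability/QuantumComplexity` (pub-qadeq lane, CLAIMS §5.1: every ranked
classical adjudication S-6 / S-12 / S-16 / S-17 / S-18 is a matrix-product-state computation that
reports a DISCARDED WEIGHT (the sum of the squared Schmidt coefficients thrown away at a bond) and
must convert it into an error bar on sampled distributions or on expectation values). This file
proves the conversion once, in the tree's vocabulary (`overlapSq`, `bornPMF`, `PMF.tvDist`), as a
companion of `PureStateSamplingBound.lean` (fidelity ↦ total variation).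

HONEST FRAMING: instance-level adjudication of specific advantage claims; no claim about BQP vs BPP
or the summit. Nothing here says that any particular simulation reaches any particular discarded
weight; the file only fixes the arithmetic `discarded weight ↦ fidelity ↦ TVD / observable error`.

## Setting

Amplitude vectors `ι → ℂ` on a finite outcome type `ι` (the computational basis), with the
sesquilinear form `braket u v = Σᵢ conj (uᵢ) vᵢ` of `overlapSq`. A finite ORTHONORMAL FAMILY
`w : κ → (ι → ℂ)` (in an MPS: the Schmidt vectors `|αₛ⟩|αₑ⟩` across one bond, written out in the
computational basis; or any orthonormal basis adapted to the truncation) and coefficients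
`c : κ → ℂ` with `Σₖ ‖cₖ‖² = 1` describe the state `ψ = Σₖ cₖ wₖ`; truncation to a set `K` of kept
indices gives `φ_K = Σ_{k ∈ K} cₖ wₖ`, kept weight `p_K = Σ_{k ∈ K} ‖cₖ‖²` and discarded weight
(truncation error) `ε_K = Σ_{k ∉ K} ‖cₖ‖² = 1 − p_K` [cite: Xiang2023, §6.2 eq. (6.13)].

## Contents (all proved, 0 named facts)

* `braket_superpose_superpose` — orthonormal expansion of `⟨Σ_A aₖwₖ | Σ_B bₗwₗ⟩ = Σ_{A∩B} conj(aₖ) bₖ`.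
* `sum_norm_sq_superpose` — `‖Σ_{k∈K} cₖ wₖ‖² = Σ_{k∈K} ‖cₖ‖²` (Parseval on the family).
* `sum_norm_sq_sub_superpose` — `‖ψ − φ_K‖² = ε_K`: the squared 2-norm of the truncation residual IS
  the discarded weight [cite: Xiang2023, §6.4 eq. (6.21)].
* `truncUnit` — the renormalised truncation `φ̂_K = φ_K / √p_K` [cite: Xiang2023, §7.3 eq. (7.30)];
  `sum_norm_sq_truncUnit` (it is a unit vector) and `overlapSq_truncUnit` — its fidelity with `ψ` is
  EXACTLY the kept weight, `|⟨ψ|φ̂_K⟩|² = p_K = 1 − ε_K` [cite: Xiang2023, §7.3 eq. (7.31):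
  `|Ψ₀⟩ = √(1−ε)|Ψ⟩ + √ε|Φ⟩`].
* `overlapSq_superpose_le_keptWeight` — optimality within the kept span: ANY unit vector supported on
  `{wₖ : k ∈ K}` has fidelity `≤ p_K` with `ψ` (Cauchy–Schwarz), so keeping the largest `‖cₖ‖²`
  (the leading Schmidt weights) is the best rank-`|K|` choice in this family
  [cite: Xiang2023, §6.4 (Rayleigh–Ritz argument around eq. (6.20))].
* `tvDist_bornPMF_truncUnit_le` — with `PureStateSamplingBound`: sampling bit strings from the
  truncated state is within total variation `√ε_K` of sampling from `ψ`.
* `abs_expect_sub_expect_le_tvDist` — for a real diagonal observable `h` with `|hᵢ − m| ≤ R`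
  (any centre `m`), `|⟨h⟩_u − ⟨h⟩_v| ≤ 2R · ‖Born(u) − Born(v)‖_TV` for unit `u, v`; hence
  `abs_expect_sub_expect_truncUnit_le`: `|⟨h⟩_ψ − ⟨h⟩_{φ̂_K}| ≤ 2R √ε_K` (e.g. a staggered
  magnetisation with values in `[−½, ½]`: error `≤ √ε_K`). [folklore; the classical half is
  Goldreich 2001 §3.8.4 Ex. 5, in the tree as `PMF.abs_tsum_toReal_mul_sub_le_tvDist`]

* (appended) `sum_norm_sq_sub_truncUnit` / `…_le` — the 2-norm defect of one renormalised
  truncation, `‖ψ − φ̂_K‖₂² = 2 − 2√p_K ≤ 2ε_K`; `dist_le_sum_step_defects` — under non-expansive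
  (e.g. unitary) steps the distance between the exact and the computed trajectory is at most the
  SUM of the per-step defects (TEBD/TDVP running-error bookkeeping, any pseudo-metric space);
  `dist_toLp_eq_sqrt_sum` — the bridge to the `ℓ²` metric of `EuclideanSpace ℂ ι`.

Not covered: which orthonormal family a given code truncates in at each step (that is data of the
run); the file converts the reported discarded weights into rigorous bounds, nothing more.

## References

* [Xiang2023] T. Xiang, *Density Matrix and Tensor Network Renormalization*, Cambridge University
  Press 2023, doi:10.1017/9781009398671: §6.2 eq. (6.13) (truncation error = discarded weight),
  §6.4 eqs. (6.18)–(6.21) (`‖Ψ − Ψ'‖² = Σ_{m>D} Λ_m`, optimal by Rayleigh–Ritz), §7.3 eqs.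
  (7.29)–(7.32) (renormalised truncated state, `|Ψ₀⟩ = √(1−ε)|Ψ⟩ + √ε|Φ⟩`). Read via
  `lit read book:xiang2023-density-matrix-tensor-network-renormalization` (chunks 104–105, 115).
* [NielsenChuang2010] for the fidelity ↦ TVD step, see `PureStateSamplingBound.lean`.
-/

noncomputable section

open Finset
open scoped ComplexConjugate

namespace Literature.Computability.QuantumComplexity

open Literature.Computability.Cryptography (bornPMF bornPMF_apply_of_sum_eq_one)

variable {ι κ : Type*} [Fintype ι]

/-! ### The sesquilinear form and orthonormal families -/

/-- `⟨u|v⟩ = Σᵢ conj (uᵢ) vᵢ`, the form whose squared modulus is `overlapSq`.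
[cite: NielsenChuang2010, §2.1.4] -/
def braket (u v : ι → ℂ) : ℂ := ∑ i, conj (u i) * v i

/-- `overlapSq u v = ‖⟨u|v⟩‖²` (definitional). [folklore] -/
theorem overlapSq_eq_norm_braket_sq (u v : ι → ℂ) : overlapSq u v = ‖braket u v‖ ^ 2 := rfl

/-- `⟨u|u⟩ = Σᵢ ‖uᵢ‖²` (as a complex number). [folklore] -/
theorem braket_self (u : ι → ℂ) : braket u u = ((∑ i, ‖u i‖ ^ 2 : ℝ) : ℂ) := by
  unfold braket
  rw [Complex.ofReal_sum]
  exact sum_congr rfl fun i _ => by rw [mul_comm, Complex.mul_conj, Complex.normSq_eq_norm_sq]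

/-- `Σᵢ ‖uᵢ‖² = Re ⟨u|u⟩`. [folklore] -/
theorem sum_norm_sq_eq_braket_re (u : ι → ℂ) : ∑ i, ‖u i‖ ^ 2 = (braket u u).re := by
  rw [braket_self, Complex.ofReal_re]

/-- An orthonormal family of amplitude vectors: `⟨wₖ|wₗ⟩ = δₖₗ`. (E.g. the Schmidt vectors of a
bipartite pure state written in the computational basis.) [cite: Xiang2023, §6.3 (Schmidt
decomposition)] -/
def IsOrthonormalFamily [DecidableEq κ] (w : κ → ι → ℂ) : Prop :=
  ∀ k l, braket (w k) (w l) = if k = l then 1 else 0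

/-- The superposition `Σ_{k ∈ K} cₖ wₖ` (truncation of `Σₖ cₖ wₖ` to the kept index set `K`).
[cite: Xiang2023, §6.4 eq. (6.17)] -/
def superpose (w : κ → ι → ℂ) (c : κ → ℂ) (K : Finset κ) : ι → ℂ :=
  fun i => ∑ k ∈ K, c k * w k i

/-- The kept weight `p_K = Σ_{k ∈ K} ‖cₖ‖²`. [cite: Xiang2023, §6.2 eq. (6.13)] -/
def keptWeight (c : κ → ℂ) (K : Finset κ) : ℝ := ∑ k ∈ K, ‖c k‖ ^ 2

/-- The discarded weight (truncation error) `ε_K = Σ_{k ∉ K} ‖cₖ‖²`.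
[cite: Xiang2023, §6.2 eq. (6.13)] -/
def discardedWeight [Fintype κ] [DecidableEq κ] (c : κ → ℂ) (K : Finset κ) : ℝ := ∑ k ∈ univ \ K, ‖c k‖ ^ 2

omit [Fintype ι] in
/-- `p_K ≥ 0`. [folklore] -/
theorem keptWeight_nonneg (c : κ → ℂ) (K : Finset κ) : 0 ≤ keptWeight c K :=
  sum_nonneg fun _ _ => sq_nonneg _

omit [Fintype ι] in
/-- `ε_K ≥ 0`. [folklore] -/
theorem discardedWeight_nonneg [Fintype κ] [DecidableEq κ] (c : κ → ℂ) (K : Finset κ) : 0 ≤ discardedWeight c K :=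
  sum_nonneg fun _ _ => sq_nonneg _

omit [Fintype ι] in
/-- `p_K + ε_K = Σₖ ‖cₖ‖²`; for normalised coefficients `p_K = 1 − ε_K`. [cite: Xiang2023, §7.3
eqs. (7.29)–(7.30)] -/
theorem keptWeight_add_discardedWeight [Fintype κ] [DecidableEq κ] (c : κ → ℂ) (K : Finset κ) :
    keptWeight c K + discardedWeight c K = ∑ k, ‖c k‖ ^ 2 := by
  unfold keptWeight discardedWeight
  rw [add_comm]
  exact sum_sdiff (subset_univ K)

omit [Fintype ι] in
/-- Normalised coefficients: `p_K = 1 − ε_K`. [cite: Xiang2023, §7.3 eq. (7.30)] -/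
theorem keptWeight_eq_one_sub [Fintype κ] [DecidableEq κ] (c : κ → ℂ) (K : Finset κ) (hc : ∑ k, ‖c k‖ ^ 2 = 1) :
    keptWeight c K = 1 - discardedWeight c K := by
  have h := keptWeight_add_discardedWeight c K
  linarith

/-! ### Orthonormal expansions -/

/-- **Orthonormal expansion of the form.** `⟨Σ_{k∈A} aₖ wₖ | Σ_{l∈B} bₗ wₗ⟩ = Σ_{k ∈ A ∩ B} conj(aₖ) bₖ`.
[folklore] -/
theorem braket_superpose_superpose [DecidableEq κ] {w : κ → ι → ℂ} (hw : IsOrthonormalFamily w) (a b : κ → ℂ)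
    (A B : Finset κ) :
    braket (superpose w a A) (superpose w b B) = ∑ k ∈ A ∩ B, conj (a k) * b k := by
  unfold braket superpose
  have h1 : ∀ i, conj (∑ k ∈ A, a k * w k i) * (∑ l ∈ B, b l * w l i) =
      ∑ k ∈ A, ∑ l ∈ B, conj (a k) * b l * (conj (w k i) * w l i) := by
    intro i
    rw [map_sum, sum_mul]
    refine sum_congr rfl fun k _ => ?_
    rw [mul_sum]
    refine sum_congr rfl fun l _ => ?_
    rw [map_mul]
    ring
  simp_rw [h1]
  rw [sum_comm]
  have h2 : ∀ k ∈ A, ∑ i, ∑ l ∈ B, conj (a k) * b l * (conj (w k i) * w l i) =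
      if k ∈ B then conj (a k) * b k else 0 := by
    intro k _
    rw [sum_comm]
    have h3 : ∀ l ∈ B, ∑ i, conj (a k) * b l * (conj (w k i) * w l i) =
        if k = l then conj (a k) * b l else 0 := by
      intro l _
      rw [← mul_sum]
      have hkl := hw k l
      unfold braket at hkl
      rw [hkl]
      split_ifs <;> simp
    rw [sum_congr rfl h3, sum_ite_eq]
  rw [sum_congr rfl h2, ← sum_filter, filter_mem_eq_inter]

/-- **Parseval on the family.** `‖Σ_{k∈K} cₖ wₖ‖² = Σ_{k∈K} ‖cₖ‖² = p_K`.
[cite: Xiang2023, §6.4 eq. (6.18) with (6.19)] -/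
theorem sum_norm_sq_superpose [DecidableEq κ] {w : κ → ι → ℂ} (hw : IsOrthonormalFamily w) (c : κ → ℂ)
    (K : Finset κ) : ∑ i, ‖superpose w c K i‖ ^ 2 = keptWeight c K := by
  rw [sum_norm_sq_eq_braket_re, braket_superpose_superpose hw, inter_self, keptWeight,
    ← Complex.ofReal_re (∑ k ∈ K, ‖c k‖ ^ 2), Complex.ofReal_sum]
  congr 1
  exact sum_congr rfl fun k _ => by rw [mul_comm, Complex.mul_conj, Complex.normSq_eq_norm_sq]

/-- The full superposition `ψ = Σₖ cₖ wₖ` is a unit vector when `Σₖ ‖cₖ‖² = 1`. [folklore] -/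
theorem sum_norm_sq_superpose_univ [Fintype κ] [DecidableEq κ] {w : κ → ι → ℂ} (hw : IsOrthonormalFamily w) (c : κ → ℂ)
    (hc : ∑ k, ‖c k‖ ^ 2 = 1) : ∑ i, ‖superpose w c univ i‖ ^ 2 = 1 := by
  rw [sum_norm_sq_superpose hw, keptWeight, hc]

/-- `⟨ψ | φ_K⟩ = p_K`: the overlap of the state with its (unnormalised) truncation is the kept
weight. [cite: Xiang2023, §7.3 eq. (7.31)] -/
theorem braket_superpose_univ_superpose [Fintype κ] [DecidableEq κ] {w : κ → ι → ℂ} (hw : IsOrthonormalFamily w) (c : κ → ℂ)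
    (K : Finset κ) : braket (superpose w c univ) (superpose w c K) = ((keptWeight c K : ℝ) : ℂ) := by
  rw [braket_superpose_superpose hw, univ_inter, keptWeight, Complex.ofReal_sum]
  exact sum_congr rfl fun k _ => by rw [mul_comm, Complex.mul_conj, Complex.normSq_eq_norm_sq]

omit [Fintype ι] in
/-- The truncation residual is the discarded part: `ψ − φ_K = Σ_{k ∉ K} cₖ wₖ`. [folklore] -/
theorem superpose_univ_sub_superpose [Fintype κ] [DecidableEq κ] (w : κ → ι → ℂ) (c : κ → ℂ) (K : Finset κ) (i : ι) :
    superpose w c univ i - superpose w c K i = superpose w c (univ \ K) i := by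
  unfold superpose
  rw [← sum_sdiff (subset_univ K)]
  ring

/-- **The squared norm of the truncation residual is the discarded weight**,
`‖ψ − φ_K‖² = ε_K`. [cite: Xiang2023, §6.4 eq. (6.21)] -/
theorem sum_norm_sq_sub_superpose [Fintype κ] [DecidableEq κ] {w : κ → ι → ℂ} (hw : IsOrthonormalFamily w) (c : κ → ℂ)
    (K : Finset κ) :
    ∑ i, ‖superpose w c univ i - superpose w c K i‖ ^ 2 = discardedWeight c K := by
  simp_rw [superpose_univ_sub_superpose]
  rw [sum_norm_sq_superpose hw]
  rfl

/-! ### The renormalised truncated state and its fidelity -/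

/-- The renormalised truncation `φ̂_K = φ_K / √p_K`. [cite: Xiang2023, §7.3 eq. (7.30)] -/
def truncUnit (w : κ → ι → ℂ) (c : κ → ℂ) (K : Finset κ) : ι → ℂ :=
  fun i => ((Real.sqrt (keptWeight c K))⁻¹ : ℝ) * superpose w c K i

/-- `φ̂_K` is a unit vector (when something is kept, `p_K > 0`). [cite: Xiang2023, §7.3 eq. (7.30)] -/
theorem sum_norm_sq_truncUnit [DecidableEq κ] {w : κ → ι → ℂ} (hw : IsOrthonormalFamily w) (c : κ → ℂ)
    {K : Finset κ} (hK : 0 < keptWeight c K) : ∑ i, ‖truncUnit w c K i‖ ^ 2 = 1 := by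
  have hs : 0 < Real.sqrt (keptWeight c K) := Real.sqrt_pos.2 hK
  have h : ∀ i, ‖truncUnit w c K i‖ ^ 2 = (keptWeight c K)⁻¹ * ‖superpose w c K i‖ ^ 2 := by
    intro i
    rw [truncUnit, norm_mul, mul_pow, Complex.norm_real, Real.norm_eq_abs, abs_inv,
      abs_of_pos hs, inv_pow, Real.sq_sqrt hK.le]
  simp_rw [h]
  rw [← mul_sum, sum_norm_sq_superpose hw, inv_mul_cancel₀ hK.ne']

/-- `⟨ψ | φ̂_K⟩ = √p_K`. [cite: Xiang2023, §7.3 eq. (7.31)] -/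
theorem braket_superpose_univ_truncUnit [Fintype κ] [DecidableEq κ] {w : κ → ι → ℂ} (hw : IsOrthonormalFamily w) (c : κ → ℂ)
    {K : Finset κ} (hK : 0 < keptWeight c K) :
    braket (superpose w c univ) (truncUnit w c K) = ((Real.sqrt (keptWeight c K) : ℝ) : ℂ) := by
  have hs : 0 < Real.sqrt (keptWeight c K) := Real.sqrt_pos.2 hK
  have h : braket (superpose w c univ) (truncUnit w c K) =
      ((Real.sqrt (keptWeight c K))⁻¹ : ℝ) * braket (superpose w c univ) (superpose w c K) := by
    unfold braket truncUnit
    rw [mul_sum]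
    exact sum_congr rfl fun i _ => by ring
  rw [h, braket_superpose_univ_superpose hw, ← Complex.ofReal_mul]
  congr 1
  nth_rw 2 [← Real.mul_self_sqrt hK.le]
  rw [← mul_assoc, inv_mul_cancel₀ hs.ne', one_mul]

/-- **Fidelity of the renormalised truncation = kept weight**: `|⟨ψ|φ̂_K⟩|² = p_K`.
[cite: Xiang2023, §7.3 eq. (7.31) (`|Ψ₀⟩ = √(1−ε)|Ψ⟩ + √ε|Φ⟩`)] -/
theorem overlapSq_truncUnit [Fintype κ] [DecidableEq κ] {w : κ → ι → ℂ} (hw : IsOrthonormalFamily w) (c : κ → ℂ)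
    {K : Finset κ} (hK : 0 < keptWeight c K) :
    overlapSq (superpose w c univ) (truncUnit w c K) = keptWeight c K := by
  rw [overlapSq_eq_norm_braket_sq, braket_superpose_univ_truncUnit hw c hK, Complex.norm_real,
    Real.norm_eq_abs, sq_abs, Real.sq_sqrt hK.le]

/-- The same for normalised coefficients, in terms of the discarded weight:
`|⟨ψ|φ̂_K⟩|² = 1 − ε_K`. [cite: Xiang2023, §7.3 eq. (7.31)] -/
theorem overlapSq_truncUnit_eq_one_sub [Fintype κ] [DecidableEq κ] {w : κ → ι → ℂ} (hw : IsOrthonormalFamily w) (c : κ → ℂ)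
    (hc : ∑ k, ‖c k‖ ^ 2 = 1) {K : Finset κ} (hK : 0 < keptWeight c K) :
    overlapSq (superpose w c univ) (truncUnit w c K) = 1 - discardedWeight c K := by
  rw [overlapSq_truncUnit hw c hK, keptWeight_eq_one_sub c K hc]

/-! ### Optimality inside the kept span -/

/-- **No unit vector in the kept span does better.** For any coefficients `d` supported on `K`
with `Σ_{k∈K} ‖dₖ‖² = 1`, `|⟨ψ | Σ_{k∈K} dₖ wₖ⟩|² ≤ p_K` (Cauchy–Schwarz); equality for
`d = c/√p_K`, i.e. for `φ̂_K`. Hence, among truncations to `|K|` members of the family, keeping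
the `|K|` largest weights maximises the fidelity. [cite: Xiang2023, §6.4 eqs. (6.20)–(6.21)] -/
theorem overlapSq_superpose_le_keptWeight [Fintype κ] [DecidableEq κ] {w : κ → ι → ℂ} (hw : IsOrthonormalFamily w)
    (c d : κ → ℂ) (K : Finset κ) (hd : ∑ k ∈ K, ‖d k‖ ^ 2 = 1) :
    overlapSq (superpose w c univ) (superpose w d K) ≤ keptWeight c K := by
  rw [overlapSq_eq_norm_braket_sq, braket_superpose_superpose hw, univ_inter]
  have h1 : ‖∑ k ∈ K, conj (c k) * d k‖ ≤ ∑ k ∈ K, ‖c k‖ * ‖d k‖ := by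
    refine (norm_sum_le _ _).trans (le_of_eq (sum_congr rfl fun k _ => ?_))
    rw [norm_mul, Complex.norm_conj]
  have h2 : ∑ k ∈ K, ‖c k‖ * ‖d k‖ ≤
      Real.sqrt (∑ k ∈ K, ‖c k‖ ^ 2) * Real.sqrt (∑ k ∈ K, ‖d k‖ ^ 2) :=
    Real.sum_mul_le_sqrt_mul_sqrt K (fun k => ‖c k‖) (fun k => ‖d k‖)
  rw [hd, Real.sqrt_one, mul_one] at h2
  have h3 : 0 ≤ ‖∑ k ∈ K, conj (c k) * d k‖ := norm_nonneg _
  have h4 := h1.trans h2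
  calc ‖∑ k ∈ K, conj (c k) * d k‖ ^ 2 ≤ (Real.sqrt (∑ k ∈ K, ‖c k‖ ^ 2)) ^ 2 :=
        pow_le_pow_left₀ h3 h4 2
    _ = keptWeight c K := Real.sq_sqrt (keptWeight_nonneg c K)

/-! ### Consequences for sampling and for diagonal observables -/

variable [Nonempty ι]

/-- **Sampling from a truncated state.** The computational-basis output distribution of the
renormalised truncation is within total variation `√ε_K` of that of `ψ`:
`‖Born(ψ) − Born(φ̂_K)‖_TV ≤ √(1 − p_K) = √ε_K`. [cite: Xiang2023, §7.3 eq. (7.31)] combined with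
[cite: NielsenChuang2010, §9.2.3 eq. (9.99)] (`PureStateSamplingBound`). -/
theorem tvDist_bornPMF_truncUnit_le [Fintype κ] [DecidableEq κ] {w : κ → ι → ℂ} (hw : IsOrthonormalFamily w) (c : κ → ℂ)
    (hc : ∑ k, ‖c k‖ ^ 2 = 1) {K : Finset κ} (hK : 0 < keptWeight c K) :
    (bornPMF (superpose w c univ)).tvDist (bornPMF (truncUnit w c K)) ≤
      Real.sqrt (discardedWeight c K) := by
  have h := tvDist_bornPMF_le_sqrt_one_sub_overlapSq (sum_norm_sq_superpose_univ hw c hc)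
    (sum_norm_sq_truncUnit hw c hK)
  rw [overlapSq_truncUnit_eq_one_sub hw c hc hK, sub_sub_cancel] at h
  exact h

/-- **Expectations of a bounded diagonal observable move by at most `2R ×` the total variation.**
For unit vectors `u, v` and a real function `h` on outcomes with `|hᵢ − m| ≤ R` for some centre `m`,
`|Σᵢ ‖uᵢ‖² hᵢ − Σᵢ ‖vᵢ‖² hᵢ| ≤ 2R · ‖Born(u) − Born(v)‖_TV`. (For `h ∈ [0,1]` take `m = ½`,
`R = ½`: the bound is the TVD itself, cf. `PMF.abs_tsum_toReal_mul_sub_le_tvDist`.) [folklore] -/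
theorem abs_expect_sub_expect_le_tvDist {u v : ι → ℂ} (hu : ∑ i, ‖u i‖ ^ 2 = 1)
    (hv : ∑ i, ‖v i‖ ^ 2 = 1) (h : ι → ℝ) {m R : ℝ} (hR : ∀ i, |h i - m| ≤ R) :
    |∑ i, ‖u i‖ ^ 2 * h i - ∑ i, ‖v i‖ ^ 2 * h i| ≤
      2 * R * (bornPMF u).tvDist (bornPMF v) := by
  rw [tvDist_bornPMF_eq hu hv]
  have hcenter : ∑ i, ‖u i‖ ^ 2 * h i - ∑ i, ‖v i‖ ^ 2 * h i =
      ∑ i, (‖u i‖ ^ 2 - ‖v i‖ ^ 2) * (h i - m) := by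
    have h1 : ∑ i, (‖u i‖ ^ 2 - ‖v i‖ ^ 2) * (h i - m) =
        ∑ i, ‖u i‖ ^ 2 * h i - ∑ i, ‖v i‖ ^ 2 * h i - m * (∑ i, ‖u i‖ ^ 2 - ∑ i, ‖v i‖ ^ 2) := by
      rw [mul_sub, mul_sum, mul_sum, ← sum_sub_distrib, ← sum_sub_distrib, ← sum_sub_distrib]
      exact sum_congr rfl fun i _ => by ring
    rw [h1, hu, hv, sub_self, mul_zero, sub_zero]
  rw [hcenter]
  calc |∑ i, (‖u i‖ ^ 2 - ‖v i‖ ^ 2) * (h i - m)|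
      ≤ ∑ i, |(‖u i‖ ^ 2 - ‖v i‖ ^ 2) * (h i - m)| := abs_sum_le_sum_abs _ _
    _ ≤ ∑ i, |‖u i‖ ^ 2 - ‖v i‖ ^ 2| * R := by
        refine sum_le_sum fun i _ => ?_
        rw [abs_mul]
        exact mul_le_mul_of_nonneg_left (hR i) (abs_nonneg _)
    _ = 2 * R * (2⁻¹ * ∑ i, |‖u i‖ ^ 2 - ‖v i‖ ^ 2|) := by rw [← sum_mul]; ring

/-- **Observable error of a truncated state.** For a real diagonal observable with `|hᵢ − m| ≤ R`,
`|⟨h⟩_ψ − ⟨h⟩_{φ̂_K}| ≤ 2R · √ε_K` — e.g. a staggered magnetisation normalised to `[−½, ½]`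
(`m = 0`, `R = ½`) is reproduced by the truncated state to within `√(discarded weight)`.
[cite: Xiang2023, §7.3] with [cite: NielsenChuang2010, §9.2.3 eq. (9.99)]. -/
theorem abs_expect_sub_expect_truncUnit_le [Fintype κ] [DecidableEq κ] {w : κ → ι → ℂ} (hw : IsOrthonormalFamily w)
    (c : κ → ℂ) (hc : ∑ k, ‖c k‖ ^ 2 = 1) {K : Finset κ} (hK : 0 < keptWeight c K) (h : ι → ℝ)
    {m R : ℝ} (hR : ∀ i, |h i - m| ≤ R) :
    |∑ i, ‖superpose w c univ i‖ ^ 2 * h i - ∑ i, ‖truncUnit w c K i‖ ^ 2 * h i| ≤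
      2 * R * Real.sqrt (discardedWeight c K) := by
  have hR0 : 0 ≤ R := (abs_nonneg _).trans (hR (Classical.arbitrary ι))
  refine (abs_expect_sub_expect_le_tvDist (sum_norm_sq_superpose_univ hw c hc)
    (sum_norm_sq_truncUnit hw c hK) h hR).trans ?_
  exact mul_le_mul_of_nonneg_left (tvDist_bornPMF_truncUnit_le hw c hc hK) (by positivity)

end Literature.Computability.QuantumComplexity

end

/-! ### Successive truncations: the 2-norm defect of one renormalised truncation, and additivity

Appended 2026-08-19 (pub-qadeq harvest-2 gen 7). A time-evolution code (TEBD / TDVP) alternates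
norm-preserving linear steps with renormalised truncations; the standard a-priori control of the
accumulated error is the triangle inequality in the 2-norm: the distance between the exactly evolved
state and the computed one is at most the SUM of the per-step truncation defects, each of which is
`‖χ − χ̂‖₂ = √(2 − 2√(1−ε)) ≤ √(2ε)` for a renormalised truncation with discarded weight `ε`
[cite: Xiang2023, §7.3 eqs. (7.30)–(7.31)] (the defect identity) and [folklore] (additivity for
non-expansive steps; e.g. the "sum of discarded weights" bookkeeping of TEBD codes is the
first-order version of this bound). -/

noncomputable section

open Finset
open scoped ComplexConjugate

namespace Literature.Computability.QuantumComplexity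

variable {ι κ : Type*} [Fintype ι]

/-- `Re ⟨ψ|φ̂_K⟩ = √p_K`. [cite: Xiang2023, §7.3 eq. (7.31)] -/
theorem re_braket_superpose_univ_truncUnit [Fintype κ] [DecidableEq κ] {w : κ → ι → ℂ}
    (hw : IsOrthonormalFamily w) (c : κ → ℂ) {K : Finset κ} (hK : 0 < keptWeight c K) :
    (braket (superpose w c univ) (truncUnit w c K)).re = Real.sqrt (keptWeight c K) := by
  rw [braket_superpose_univ_truncUnit hw c hK, Complex.ofReal_re]

/-- **2-norm defect of a renormalised truncation**: `‖ψ − φ̂_K‖₂² = 2 − 2√p_K` for normalised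
coefficients. [cite: Xiang2023, §7.3 eq. (7.31)] -/
theorem sum_norm_sq_sub_truncUnit [Fintype κ] [DecidableEq κ] {w : κ → ι → ℂ}
    (hw : IsOrthonormalFamily w) (c : κ → ℂ) (hc : ∑ k, ‖c k‖ ^ 2 = 1) {K : Finset κ}
    (hK : 0 < keptWeight c K) :
    ∑ i, ‖superpose w c univ i - truncUnit w c K i‖ ^ 2 = 2 - 2 * Real.sqrt (keptWeight c K) := by
  rw [sum_norm_sub_sq_eq (sum_norm_sq_superpose_univ hw c hc) (sum_norm_sq_truncUnit hw c hK)]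
  rw [show (∑ i, conj (superpose w c univ i) * truncUnit w c K i).re =
    (braket (superpose w c univ) (truncUnit w c K)).re from rfl,
    re_braket_superpose_univ_truncUnit hw c hK]

/-- **The defect is at most `2ε_K`**: `‖ψ − φ̂_K‖₂² ≤ 2 ε_K` (since `√p ≥ p` on `[0,1]`), i.e.
`‖ψ − φ̂_K‖₂ ≤ √(2 ε_K)`. [folklore] -/
theorem sum_norm_sq_sub_truncUnit_le [Fintype κ] [DecidableEq κ] {w : κ → ι → ℂ}
    (hw : IsOrthonormalFamily w) (c : κ → ℂ) (hc : ∑ k, ‖c k‖ ^ 2 = 1) {K : Finset κ}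
    (hK : 0 < keptWeight c K) :
    ∑ i, ‖superpose w c univ i - truncUnit w c K i‖ ^ 2 ≤ 2 * discardedWeight c K := by
  rw [sum_norm_sq_sub_truncUnit hw c hc hK]
  have hε : discardedWeight c K = 1 - keptWeight c K := by
    linarith [keptWeight_eq_one_sub c K hc]
  rw [hε]
  set p : ℝ := keptWeight c K with hp
  have hp1 : p ≤ 1 := by linarith [discardedWeight_nonneg c K]
  have hs0 : 0 ≤ Real.sqrt p := Real.sqrt_nonneg p
  have hs1 : Real.sqrt p ≤ 1 := Real.sqrt_le_one.mpr hp1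
  have h2 : Real.sqrt p * Real.sqrt p = p := Real.mul_self_sqrt hK.le
  nlinarith

/-- `‖ψ − φ̂_K‖₂ ≤ √(2 ε_K)`, square-root form of `sum_norm_sq_sub_truncUnit_le`. [folklore] -/
theorem sqrt_sum_norm_sq_sub_truncUnit_le [Fintype κ] [DecidableEq κ] {w : κ → ι → ℂ}
    (hw : IsOrthonormalFamily w) (c : κ → ℂ) (hc : ∑ k, ‖c k‖ ^ 2 = 1) {K : Finset κ}
    (hK : 0 < keptWeight c K) :
    Real.sqrt (∑ i, ‖superpose w c univ i - truncUnit w c K i‖ ^ 2) ≤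
      Real.sqrt (2 * discardedWeight c K) :=
  Real.sqrt_le_sqrt (sum_norm_sq_sub_truncUnit_le hw c hc hK)

omit [Fintype ι] in
/-- **Additivity of step defects under non-expansive evolution.** In any (pseudo)metric space let
`f k` be non-expansive maps (e.g. unitaries), `x` the exact trajectory `x (k+1) = f k (x k)` and
`y` any computed trajectory with the same start. Then
`dist (x n) (y n) ≤ Σ_{k<n} dist (f k (y k)) (y (k+1))` — the accumulated error is at most the sum
of the per-step defects (for a TEBD step: the truncation defect `≤ √(2ε_k)` above). [folklore] -/
theorem dist_le_sum_step_defects {α : Type*} [PseudoMetricSpace α] (f : ℕ → α → α)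
    (hf : ∀ k a b, dist (f k a) (f k b) ≤ dist a b) (x y : ℕ → α) (h0 : x 0 = y 0)
    (hx : ∀ k, x (k + 1) = f k (x k)) (n : ℕ) :
    dist (x n) (y n) ≤ ∑ k ∈ range n, dist (f k (y k)) (y (k + 1)) := by
  induction n with
  | zero => simp [h0]
  | succ n ih =>
    rw [sum_range_succ, hx n]
    calc dist (f n (x n)) (y (n + 1))
        ≤ dist (f n (x n)) (f n (y n)) + dist (f n (y n)) (y (n + 1)) := dist_triangle _ _ _
      _ ≤ dist (x n) (y n) + dist (f n (y n)) (y (n + 1)) :=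
          add_le_add (hf n _ _) le_rfl
      _ ≤ _ := add_le_add ih le_rfl

omit [Fintype ι] in
/-- The same with per-step bounds `δ k`: `dist (x n) (y n) ≤ Σ_{k<n} δ k`. [folklore] -/
theorem dist_le_sum_of_step_defects_le {α : Type*} [PseudoMetricSpace α] (f : ℕ → α → α)
    (hf : ∀ k a b, dist (f k a) (f k b) ≤ dist a b) (x y : ℕ → α) (h0 : x 0 = y 0)
    (hx : ∀ k, x (k + 1) = f k (x k)) (δ : ℕ → ℝ) (hδ : ∀ k, dist (f k (y k)) (y (k + 1)) ≤ δ k)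
    (n : ℕ) : dist (x n) (y n) ≤ ∑ k ∈ range n, δ k :=
  (dist_le_sum_step_defects f hf x y h0 hx n).trans (sum_le_sum fun k _ => hδ k)

/-- Bridge to the `ℓ²` metric: for amplitude vectors viewed in `EuclideanSpace ℂ ι`, the distance
is `√(Σᵢ ‖uᵢ − vᵢ‖²)` — so `sqrt_sum_norm_sq_sub_truncUnit_le` is exactly a step-defect bound
`dist ≤ √(2ε)` in the sense of `dist_le_sum_of_step_defects_le`. [folklore] -/
theorem dist_toLp_eq_sqrt_sum (u v : ι → ℂ) :
    dist (WithLp.toLp 2 u : EuclideanSpace ℂ ι) (WithLp.toLp 2 v) =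
      Real.sqrt (∑ i, ‖u i - v i‖ ^ 2) := by
  rw [EuclideanSpace.dist_eq]
  simp [dist_eq_norm]

end Literature.Computability.QuantumComplexity

end
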